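import Summits.HubbardSuperconductivity.HubbardSuperconductivity.Theses.WeakCouplingBCS
import Summits.HubbardSuperconductivity.HubbardSuperconductivity.Statement
import HarnessLib.Audit.CruxProbe

/-! BC7 / P5 mechanical placement of crux `WcbcsSsbToTorusLRO` (stmt-HubbardSuperconductivity-2009),
redirect strategist r1, 2026-08-17. -/

set_option h21.cruxProbe.batteryMs 90000 in
set_option h21.cruxProbe.totalMs 300000 in
#h21_crux_probe Summit.HubbardSuperconductivity.HubbardSuperconductivity.Theses.WeakCouplingBCS.WcbcsSsbToTorusLRO route := "route-HubbardSuperconductivity-WeakCouplingBCS"
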